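import Summits.BirchSwinnertonDyer.BirchSwinnertonDyer.Theorems.BiquadraticEisensteinDescentManinDatumSupercuspidalCMInertSexticDictionaryPackaging
import HarnessLib

set_option linter.dupNamespace false -- `Summit.BirchSwinnertonDyer.BirchSwinnertonDyer.Theorems.…` (summit = sub, D-0017)
set_option autoImplicit false

/-!
# Crux `ManinDatumSupercuspidalCMInert` (stmt-BirchSwinnertonDyer-20111, BED r605) BY NAME modulo ONE Literature-sized input: the sextic theta
# dictionary of `E^k : y² = x³ + k` on the single good-at-`2` class `k = 16u`, `u ≡ 1 (4)`
# (width seat `bsd-wall-cm-bed-w3` g11; theorems only; route cone; `--supports 20111`, helper)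

Route `BiquadraticEisensteinDescent` (cell `pub/bsd-wall`). With `…SexticDictionaryPackaging.dictDataRho_of_not_goodAtTwo` (p651734: the landed
dictionary of bed-w2 g11 packaged outside the good-at-`2` class) the hypothesis `hdictAllRho` of `…OfSexticDictionaryMulCharRho` splits by
`by_cases` on `∃ u, u ≡ 1 (4) ∧ k = 16u`; only the good-at-`2` class remains as a hypothesis:

* `hdictAllRho_of_goodAtTwo` — `hgood → hdictAllRho`, where `hgood` asks for the dictionary data (the `∃`-body of `hdictAllRho`) ONLY for `k ≠ 0`,
  `5 ∣ k`, sixth-power-free, `k = 16u` with `u ≡ 1 (4)`, `ℓ` prime with `ℓ ∤ k`, `χ` mod `ℓ` (no parity / congruence condition on `ℓ` is used);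
* ★ `maninDatumSupercuspidalCMInert_of_goodAtTwoDictionary` — **`hgood → ManinDatumSupercuspidalCMInert`** (crux BY NAME).

READING for the planner: crux 20111 = `hgood` EXACTLY = Ireland–Rosen Ch. 18 §7 for the Mordell curves `y² = x³ + 16u`, `u ≡ 1 (4)`, `5 ∣ u`
(good reduction at `2`, `a₂ = 0`), in the export shape of `SexticTwist.lSeries_twist_eq_thetaLFunction_five` (announced by bed-w2 g11 / bed-w1 g9).
HONEST FRAMING: `hgood` is NOT proved here; the crux, its parent, Manin's conjecture and BSD are NOT proved by this. No definition, no named fact,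
no `sorry`; axioms standard.
-/

noncomputable section

open scoped Classical
open Complex
open Literature.NumberTheory.EllipticCurves
open Literature.NumberTheory.LFunctions
open Summit.BirchSwinnertonDyer.BirchSwinnertonDyer.Theses.BiquadraticEisensteinDescent

namespace Summit.BirchSwinnertonDyer.BirchSwinnertonDyer.Theorems.BiquadraticEisensteinDescentManinDatumSupercuspidalCMInertOfGoodAtTwoDictionary

open Summit.BirchSwinnertonDyer.BirchSwinnertonDyer.Theorems.BiquadraticEisensteinDescentManinDatumSupercuspidalCMInertSexticDictionaryPackaging
  (dictDataRho_of_not_goodAtTwo)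
open Summit.BirchSwinnertonDyer.BirchSwinnertonDyer.Theorems.BiquadraticEisensteinDescentManinDatumSupercuspidalCMInertOfSexticDictionaryMulCharRho
  (maninDatumSupercuspidalCMInert_of_sexticDictionary_mulCharRho)

/-- **`hdictAllRho` from the good-at-`2` class alone**: outside `k = 16u`, `u ≡ 1 (4)` the dictionary data are the tree theorem
`dictDataRho_of_not_goodAtTwo` (bed-w2 g11's `SexticTwist.lSeries_twist_eq_thetaLFunction_five`). [cite: IrelandRosen1990, Ch. 18 §7] -/
theorem hdictAllRho_of_goodAtTwo
    (hgood : ∀ (k : ℤ), k ≠ 0 → (5 : ℤ) ∣ k → (∀ q : ℕ, q.Prime → ¬ ((q : ℤ) ^ 6 ∣ k)) → (∃ u : ℤ, u % 4 = 1 ∧ k = 16 * u) →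
      ∀ (ℓ : ℕ) [NeZero ℓ], ℓ.Prime → ¬ (ℓ : ℤ) ∣ k → ∀ χ : DirichletCharacter ℂ ℓ,
      ∃ (e k₁ M' : ℕ) (_ : NeZero M') (Φ₅ : ZMod 5 × ZMod 5 → ℂ) (Ψ W : ℤ × ℤ → ℂ) (L : ℂ → ℂ) (u : ℂ) (N : ℕ),
        1 ≤ e ∧ e ≤ 5 ∧ k.natAbs = 5 ^ e * k₁ ∧ Nat.Coprime 5 M' ∧
        Φ₅ 0 = 0 ∧
        (∀ d d' : ZMod 5 × ZMod 5, Φ₅ (d.1 * d'.2 + d.2 * d'.1 - d.1 * d'.1, d.2 * d'.2 - d.1 * d'.1) = Φ₅ d * Φ₅ d') ∧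
        Φ₅ (-1, 1) = (-(UpperHalfPlane.ρ : ℂ) ^ 2) ^ e ∧
        (∀ y z : ℤ × ℤ, Ψ (y.1 + M' * z.1, y.2 + M' * z.2) = Ψ y) ∧ (∀ y : ℤ × ℤ, IsIntegral ℤ (Ψ y)) ∧
        (∀ y : ℤ × ℤ, W y = Φ₅ ((y.2 : ZMod 5), ((y.1 + y.2 : ℤ) : ZMod 5)) * Ψ y) ∧
        Differentiable ℂ L ∧
        (∀ s : ℂ, 2 < s.re →
          L s = LSeries (fun n : ℕ ↦ χ⁻¹ (n : ZMod ℓ) * ((⟨0, 0, 0, 0, (k : ℚ)⟩ : WeierstrassCurve ℚ).LFunction n : ℂ)) s) ∧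
        IsIntegral ℤ u ∧ ¬ 5 ∣ N ∧
        L 1 = u / N * BinaryTheta.thetaLFunction 3 (2 * (5 * M')) 1 (-((Real.sqrt (3 : ℕ) : ℂ) * I))
          (QuadOrder.parityLift W) 1) :
    ∀ (k : ℤ), k ≠ 0 → (5 : ℤ) ∣ k → (∀ q : ℕ, q.Prime → ¬ ((q : ℤ) ^ 6 ∣ k)) →
      ∀ (ℓ : ℕ) [NeZero ℓ], ℓ.Prime → 5 ≤ ℓ → ¬ (ℓ : ℤ) ∣ k → ¬ 4 ∣ ℓ - 1 → ¬ 5 ∣ ℓ - 1 →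
        IsSquare ((5 : ℕ) : ZMod ℓ) →
      ∀ χ : DirichletCharacter ℂ ℓ, χ.Odd →
      ∃ (e k₁ M' : ℕ) (_ : NeZero M') (Φ₅ : ZMod 5 × ZMod 5 → ℂ) (Ψ W : ℤ × ℤ → ℂ) (L : ℂ → ℂ) (u : ℂ) (N : ℕ),
        1 ≤ e ∧ e ≤ 5 ∧ k.natAbs = 5 ^ e * k₁ ∧ Nat.Coprime 5 M' ∧
        Φ₅ 0 = 0 ∧
        (∀ d d' : ZMod 5 × ZMod 5, Φ₅ (d.1 * d'.2 + d.2 * d'.1 - d.1 * d'.1, d.2 * d'.2 - d.1 * d'.1) = Φ₅ d * Φ₅ d') ∧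
        Φ₅ (-1, 1) = (-(UpperHalfPlane.ρ : ℂ) ^ 2) ^ e ∧
        (∀ y z : ℤ × ℤ, Ψ (y.1 + M' * z.1, y.2 + M' * z.2) = Ψ y) ∧ (∀ y : ℤ × ℤ, IsIntegral ℤ (Ψ y)) ∧
        (∀ y : ℤ × ℤ, W y = Φ₅ ((y.2 : ZMod 5), ((y.1 + y.2 : ℤ) : ZMod 5)) * Ψ y) ∧
        Differentiable ℂ L ∧
        (∀ s : ℂ, 2 < s.re →
          L s = LSeries (fun n : ℕ ↦ χ⁻¹ (n : ZMod ℓ) * ((⟨0, 0, 0, 0, (k : ℚ)⟩ : WeierstrassCurve ℚ).LFunction n : ℂ)) s) ∧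
        IsIntegral ℤ u ∧ ¬ 5 ∣ N ∧
        L 1 = u / N * BinaryTheta.thetaLFunction 3 (2 * (5 * M')) 1 (-((Real.sqrt (3 : ℕ) : ℂ) * I))
          (QuadOrder.parityLift W) 1 := by
  intro k hk h5k h6 ℓ _ hℓ _ hℓk _ _ _ χ _
  by_cases h2 : ∃ u : ℤ, u % 4 = 1 ∧ k = 16 * u
  · exact hgood k hk h5k h6 h2 ℓ hℓ hℓk χ
  · exact dictDataRho_of_not_goodAtTwo k hk h5k h6 h2 ℓ hℓ hℓk χ

/-- ★ **`hgood → ManinDatumSupercuspidalCMInert`**: the crux BY NAME modulo the sextic theta dictionary on the single good-at-`2` class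
`k = 16u`, `u ≡ 1 (4)` — everything else (the CM core at `5`, the periods, the CRT/lattice/`L`-value assembly, the `j = 1728` half `stub_S7`,
and the dictionary at every additive-at-`2` class) is a tree theorem. [cite: IrelandRosen1990, Ch. 18 §7] [cite: Rubin1999, §7.4 Prop. 7.15]
[cite: Manin1972, Thm. 1.6] -/
theorem maninDatumSupercuspidalCMInert_of_goodAtTwoDictionary
    (hgood : ∀ (k : ℤ), k ≠ 0 → (5 : ℤ) ∣ k → (∀ q : ℕ, q.Prime → ¬ ((q : ℤ) ^ 6 ∣ k)) → (∃ u : ℤ, u % 4 = 1 ∧ k = 16 * u) →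
      ∀ (ℓ : ℕ) [NeZero ℓ], ℓ.Prime → ¬ (ℓ : ℤ) ∣ k → ∀ χ : DirichletCharacter ℂ ℓ,
      ∃ (e k₁ M' : ℕ) (_ : NeZero M') (Φ₅ : ZMod 5 × ZMod 5 → ℂ) (Ψ W : ℤ × ℤ → ℂ) (L : ℂ → ℂ) (u : ℂ) (N : ℕ),
        1 ≤ e ∧ e ≤ 5 ∧ k.natAbs = 5 ^ e * k₁ ∧ Nat.Coprime 5 M' ∧
        Φ₅ 0 = 0 ∧
        (∀ d d' : ZMod 5 × ZMod 5, Φ₅ (d.1 * d'.2 + d.2 * d'.1 - d.1 * d'.1, d.2 * d'.2 - d.1 * d'.1) = Φ₅ d * Φ₅ d') ∧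
        Φ₅ (-1, 1) = (-(UpperHalfPlane.ρ : ℂ) ^ 2) ^ e ∧
        (∀ y z : ℤ × ℤ, Ψ (y.1 + M' * z.1, y.2 + M' * z.2) = Ψ y) ∧ (∀ y : ℤ × ℤ, IsIntegral ℤ (Ψ y)) ∧
        (∀ y : ℤ × ℤ, W y = Φ₅ ((y.2 : ZMod 5), ((y.1 + y.2 : ℤ) : ZMod 5)) * Ψ y) ∧
        Differentiable ℂ L ∧
        (∀ s : ℂ, 2 < s.re →
          L s = LSeries (fun n : ℕ ↦ χ⁻¹ (n : ZMod ℓ) * ((⟨0, 0, 0, 0, (k : ℚ)⟩ : WeierstrassCurve ℚ).LFunction n : ℂ)) s) ∧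
        IsIntegral ℤ u ∧ ¬ 5 ∣ N ∧
        L 1 = u / N * BinaryTheta.thetaLFunction 3 (2 * (5 * M')) 1 (-((Real.sqrt (3 : ℕ) : ℂ) * I))
          (QuadOrder.parityLift W) 1) :
    ManinDatumSupercuspidalCMInert :=
  maninDatumSupercuspidalCMInert_of_sexticDictionary_mulCharRho (hdictAllRho_of_goodAtTwo hgood)

end Summit.BirchSwinnertonDyer.BirchSwinnertonDyer.Theorems.BiquadraticEisensteinDescentManinDatumSupercuspidalCMInertOfGoodAtTwoDictionary

end
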